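import Literature.NumberTheory.GelbartRogawski1991.QuadExtSplittingCharArchType
import HarnessLib

/-!
# The archimedean components of a splitting character of a quadratic extension at a REAL place of the top field (type (ii))

Topic `NumberTheory/GelbartRogawski1991`; namespace `Literature.NumberTheory.GelbartRogawski1991.UnitaryDualPair.ArchSplitting.QuadExt`
(continues `QuadExtSplittingCharArchType`, the type-(i) file).  KERNEL only: proved theorems; no definition, no named fact, no `sorry`.

For a quadratic extension `E/F` of number fields with non-trivial `F`-automorphism `c` and a REAL place `w` of `E` (type (ii): the
place `v = w|_F` is real and SPLITS in `E`, `E ⊗_F F_v = E_w × E_{cw} = ℝ × ℝ`, `c` swapping the two factors):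

* §1 `smul_ne_of_isReal` (`c • w ≠ w`: a real place is unramified, its stabiliser in `Aut(E/F)` is trivial — Mathlib
  `IsUnramified.stabilizer_eq_bot`), `comap_smul_eq'` (`c • w ∣ v`), **`eq_or_eq_smul_of_isReal`** (the places over `v` are exactly
  `w` and `c • w`: Mathlib's count `#unramified + 2·#ramified = [E : F] = 2` over `v`), `univ_infPlacesOver_eq_pair_of_isReal`;
* §2 `embedding_pos_of_isReal` (`σ_v(δ²) = σ_w(δ)² > 0`: `σ_w` is a real embedding), **`embedding_quadExtGenerator_pos_of_isReal`**
  (`σ_v(θ) > 0` for the generator `E = F(√θ)`, `θ = quadExtGenerator F E`, since `δ² = θ t²`) — the converse companion of the type-(i)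
  `embedding_quadExtGenerator_lt_zero_of_smul_eq`;
* §3 for a Hecke character `χ` of `E` with `χ|_{𝕀_F} = ε_{E/F}^m` (`IsSplittingCharExt F E m χ`):
  **`IsSplittingCharExt.archComponent_mul_archComponent_smul_of_isReal`** — `χ_w(ι_w x) · χ_{cw}(ι_{cw} x) = 1` for `x ∈ F_vˣ`
  (`ε_{E/F,v} = 1` at a split real place: `prod_archComponent_placesOver_of_pos` summed over the pair `{w, c • w}`), the type-(ii)
  twin of `archComponent_mul_archComponent_of_isComplex` (complex places of `F`) — the character-side input of the twist at the
  real places of `E` in the general-`E/F` kernel construction of [GelbartRogawski1991, Prop. 3.1.1] (stage-1 cell `pub-hodgecm`,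
  GR lane Track 2).

## References

* [HarrisKudlaSweet1996] M. Harris, S. Kudla, W. Sweet, JAMS 9 (1996), §1 (1.5) p. 951.
* [GelbartRogawski1991] S. Gelbart, J. Rogawski, Invent. Math. 105 (1991), §3.1 p. 454, p. 456 (3.1.2).
* [PlatonovRapinchuk1994] V. Platonov, A. Rapinchuk, *Algebraic Groups and Number Theory* (1994), §2.3, §3.2 (split places).
-/

set_option autoImplicit false

noncomputable section

open scoped NumberField Classical ComplexConjugate
open NumberField NumberField.InfinitePlace IsDedekindDomain

open _root_.Literature.NumberTheory.Automorphic _root_.Literature.NumberTheory.Automorphic.UnitaryGroup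
open _root_.Literature.NumberTheory.GaloisRepresentations
open _root_.Literature.RepresentationTheory.HarrisKudlaSweet1996

namespace Literature.NumberTheory.GelbartRogawski1991.UnitaryDualPair.ArchSplitting.QuadExt

variable (F : Type) [Field F] [NumberField F] (E : Type) [Field E] [NumberField E] [Algebra F E]
  [Algebra.IsQuadraticExtension F E] (c : E ≃ₐ[F] E) (w : {w : InfinitePlace E // w.IsReal})

/-! ## §1 A real place of `E`: `c • w ≠ w`, and the places over `v = w|_F` are exactly `w`, `c • w` -/

section Place

omit [NumberField F] [NumberField E] [Algebra.IsQuadraticExtension F E] in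
/-- **`c • w ≠ w` for a real place `w` and `c ≠ 1`**: a real place is unramified over `F`, so its stabiliser in `Aut(E/F)` is
trivial. [cite: PlatonovRapinchuk1994, §2.3] -/
theorem smul_ne_of_isReal (hc : c ≠ 1) : c • w.1 ≠ w.1 := by
  intro h
  have hstab : c ∈ MulAction.stabilizer (E ≃ₐ[F] E) w.1 := h
  have hunr : w.1.IsUnramified F := isUnramified_iff.2 (Or.inl w.2)
  rw [hunr.stabilizer_eq_bot, Subgroup.mem_bot] at hstab
  exact hc hstab

omit [NumberField F] [NumberField E] [Algebra.IsQuadraticExtension F E] in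
/-- `c • w` lies over the same place of `F` as `w` (`c` is `F`-linear). [cite: PlatonovRapinchuk1994, §2.3] -/
theorem comap_smul_eq' (w₀ : InfinitePlace E) : (c • w₀).comap (algebraMap F E) = w₀.comap (algebraMap F E) := by
  rw [comap_smul]
  congr 1
  ext x
  exact c.symm.commutes x

/-- **the places over `v = w|_F` are `w` and `c • w`** (quadratic `E/F`, `w` real, `c ≠ 1`): both are unramified over `v`, they are
distinct, and `#unramified + 2 · #ramified = [E : F] = 2` (Mathlib `unramifedPlacesOver_ncard_add_eq_finrank`).
[cite: GelbartRogawski1991, §3.1 p. 454] -/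
theorem eq_or_eq_smul_of_isReal (hc : c ≠ 1) (w' : InfinitePlace E)
    (h : w'.comap (algebraMap F E) = w.1.comap (algebraMap F E)) : w' = w.1 ∨ w' = c • w.1 := by
  set v := w.1.comap (algebraMap F E) with hv
  have hcount := unramifedPlacesOver_ncard_add_eq_finrank (K := F) (L := E) (v := v)
  rw [Algebra.IsQuadraticExtension.finrank_eq_two F E] at hcount
  have hwmem : w.1 ∈ unramifiedPlacesOver E v :=
    ⟨(mem_placesOver_iff E v w.1).2 rfl, isUnramified_iff.2 (Or.inl w.2)⟩
  have hcwmem : c • w.1 ∈ unramifiedPlacesOver E v :=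
    ⟨(mem_placesOver_iff E v (c • w.1)).2 (comap_smul_eq' F E c w.1), isUnramified_iff.2 (Or.inl (isReal_smul_iff.2 w.2))⟩
  have hne : c • w.1 ≠ w.1 := smul_ne_of_isReal F E c w hc
  have hsub : ({w.1, c • w.1} : Set (InfinitePlace E)) ⊆ unramifiedPlacesOver E v := by
    intro x hx
    rcases hx with rfl | hx
    · exact hwmem
    · rw [Set.mem_singleton_iff] at hx
      rw [hx]
      exact hcwmem
  have hpair : ({w.1, c • w.1} : Set (InfinitePlace E)).ncard = 2 := Set.ncard_pair hne.symm
  have hle : (unramifiedPlacesOver E v).ncard ≤ ({w.1, c • w.1} : Set (InfinitePlace E)).ncard := by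
    rw [hpair]; omega
  have heq : ({w.1, c • w.1} : Set (InfinitePlace E)) = unramifiedPlacesOver E v :=
    Set.eq_of_subset_of_ncard_le hsub hle (Set.toFinite _)
  have hram : (ramifiedPlacesOver E v).ncard = 0 := by
    rw [← heq, hpair] at hcount
    omega
  have hram' : ramifiedPlacesOver E v = ∅ := (Set.ncard_eq_zero (Set.toFinite _)).1 hram
  have hw'mem : w' ∈ placesOver E v := (mem_placesOver_iff E v w').2 h
  rw [← union_ramifiedPlacesOver_unramifiedPlacesOver, hram', Set.empty_union, ← heq] at hw'mem
  rcases hw'mem with h1 | h1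
  · exact Or.inl h1
  · exact Or.inr (Set.mem_singleton_iff.1 h1)

/-- the places over `v = w|_F`, as a `Finset` of `InfPlacesOver E v`: the pair `{w, c • w}`. [cite: GelbartRogawski1991, §3.1 p. 454] -/
theorem univ_infPlacesOver_eq_pair_of_isReal (hc : c ≠ 1) :
    (Finset.univ : Finset (InfPlacesOver E (w.1.comap (algebraMap F E)))) =
      {⟨w.1, rfl⟩, ⟨c • w.1, comap_smul_eq' F E c w.1⟩} := by
  ext w'
  simp only [Finset.mem_univ, Finset.mem_insert, Finset.mem_singleton, true_iff]
  rcases eq_or_eq_smul_of_isReal F E c w hc w'.1 w'.2 with h | h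
  · exact Or.inl (Subtype.ext h)
  · exact Or.inr (Subtype.ext h)

end Place

/-! ## §2 `σ_v(θ) > 0`: the real place below a real place splits -/

section Sign

omit [NumberField F] [NumberField E] [Algebra.IsQuadraticExtension F E] in
/-- `σ_v(d) = σ_w(δ)² > 0` for `δ² = d`, `δ ≠ 0`, at a REAL place `w` (`σ_w δ` is a non-zero real number).
[cite: GelbartRogawski1991, §3.1 p. 454] -/
theorem embedding_pos_of_isReal {δ : E} (hδ : δ ≠ 0) {d : F} (hd : δ * δ = algebraMap F E d) :
    0 < embedding_of_isReal (w.2.comap (algebraMap F E)) d := by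
  have hv : (w.1.comap (algebraMap F E)).IsReal := w.2.comap (algebraMap F E)
  have hemb := Weil1964.embedding_comp_eq_of_isReal F E (w.1.comap (algebraMap F E)) hv ⟨w.1, rfl⟩
  have h1 : ((embedding_of_isReal hv d : ℝ) : ℂ) = w.1.embedding δ * w.1.embedding δ := by
    rw [embedding_of_isReal_apply, ← hemb, RingHom.comp_apply, ← hd, map_mul]
  -- `σ_w δ` is real and non-zero
  have hreal : (w.1.embedding δ : ℂ) = ((embedding_of_isReal w.2 δ : ℝ) : ℂ) := (embedding_of_isReal_apply w.2 δ).symm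
  have hne : embedding_of_isReal w.2 δ ≠ 0 := (_root_.map_ne_zero _).2 hδ
  have h2 : embedding_of_isReal hv d = embedding_of_isReal w.2 δ ^ 2 := by
    apply Complex.ofReal_injective
    rw [h1, hreal]
    push_cast
    ring
  rw [h2]
  positivity

omit [NumberField E] in
/-- **`σ_v(θ) > 0`** for the generator `θ = quadExtGenerator F E` (`E = F(√θ)`) at the real place `v` below a REAL place `w` of `E`
(`δ² = θ t²` with `t ∈ Fˣ`): `v` splits in `E`. [cite: GelbartRogawski1991, §3.1 p. 454] -/
theorem embedding_quadExtGenerator_pos_of_isReal [NumberField E] {δ : E} (hcδ : c δ = -δ) (hδ : δ ≠ 0) :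
    0 < embedding_of_isReal (w.2.comap (algebraMap F E)) ((quadExtGenerator F E : 𝓞 F) : F) := by
  obtain ⟨d, hd⟩ := exists_mul_self_eq_algebraMap E c hcδ hδ
  have hδF : ∀ r : F, algebraMap F E r ≠ δ := fun r hr =>
    not_mem_range_algebraMap_of_apply_eq_neg E c hcδ hδ ⟨r, hr⟩
  obtain ⟨t, ht0, hdt⟩ := exists_sq_eq_quadExtGenerator_mul_sq (F := F) (E := E) hδF hd
  have hpos := embedding_pos_of_isReal F E w hδ hd
  rw [hdt, map_mul, map_pow] at hpos
  have ht : 0 < embedding_of_isReal (w.2.comap (algebraMap F E)) t ^ 2 := by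
    have hne : embedding_of_isReal (w.2.comap (algebraMap F E)) t ≠ 0 := (_root_.map_ne_zero _).2 ht0
    positivity
  exact (mul_pos_iff_of_pos_right ht).1 hpos

end Sign

/-! ## §3 `χ_w(ι_w x) · χ_{cw}(ι_{cw} x) = 1` at a real place of `E` -/

section Splitting

variable {F E}

/-- **at a REAL place `w` of `E`: `∏_{w' ∣ v} χ_{w'}(ι_{w'} x) = 1`** for `χ|_{𝕀_F} = ε_{E/F}^m`, `v = w|_F`, `x ∈ F_vˣ` (`v` splits,
`ε_{E/F,v} = 1`). [cite: HarrisKudlaSweet1996, §1 (1.5) p. 951] -/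
theorem _root_.Literature.RepresentationTheory.HarrisKudlaSweet1996.IsSplittingCharExt.prod_archComponent_placesOver_of_isReal
    {m : ℕ} {χ : HeckeCharacter E} (hχ : IsSplittingCharExt F E m χ) {δ : E} (hcδ : c δ = -δ) (hδ : δ ≠ 0)
    (x : ((w.1.comap (algebraMap F E)).Completion)ˣ) :
    ∏ w' : InfPlacesOver E (w.1.comap (algebraMap F E)),
      χ.archComponent w'.1 (Units.map (toInfPlace E (w.1.comap (algebraMap F E)) w').toMonoidHom x) = 1 :=
  hχ.prod_archComponent_placesOver_of_pos (w.2.comap (algebraMap F E))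
    (embedding_quadExtGenerator_pos_of_isReal F E c w hcδ hδ) x

/-- **at a REAL place `w` of `E`, in pairs: `χ_w(ι_w x) · χ_{cw}(ι_{cw} x) = 1`** for `χ|_{𝕀_F} = ε_{E/F}^m`, `c ≠ 1`, `v = w|_F`,
`x ∈ F_vˣ` — the two places over the split real place `v` are `w` and `c • w`.  The type-(ii) twin of
`archComponent_mul_archComponent_of_isComplex`. [cite: GelbartRogawski1991, §3.1 p. 456 (3.1.2)] -/
theorem _root_.Literature.RepresentationTheory.HarrisKudlaSweet1996.IsSplittingCharExt.archComponent_mul_archComponent_smul_of_isReal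
    {m : ℕ} {χ : HeckeCharacter E} (hχ : IsSplittingCharExt F E m χ) (hc : c ≠ 1) {δ : E} (hcδ : c δ = -δ) (hδ : δ ≠ 0)
    (x : ((w.1.comap (algebraMap F E)).Completion)ˣ) :
    χ.archComponent w.1 (Units.map (toInfPlace E (w.1.comap (algebraMap F E)) ⟨w.1, rfl⟩).toMonoidHom x) *
      χ.archComponent (c • w.1)
        (Units.map (toInfPlace E (w.1.comap (algebraMap F E)) ⟨c • w.1, comap_smul_eq' F E c w.1⟩).toMonoidHom x) = 1 := by
  have h := hχ.prod_archComponent_placesOver_of_isReal c w hcδ hδ x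
  have hne : (⟨w.1, rfl⟩ : InfPlacesOver E (w.1.comap (algebraMap F E))) ≠ ⟨c • w.1, comap_smul_eq' F E c w.1⟩ :=
    fun h' => smul_ne_of_isReal F E c w hc (congrArg Subtype.val h').symm
  rwa [univ_infPlacesOver_eq_pair_of_isReal F E c w hc, Finset.prod_pair hne] at h

end Splitting

end Literature.NumberTheory.GelbartRogawski1991.UnitaryDualPair.ArchSplitting.QuadExt

end
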